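/-
Copyright (c) 2026. All rights reserved.
Released under Apache 2.0 license as described in the file LICENSE.
Authors: abc-iut cell, seat abc-iut-w5-d053 (gen 4; row «COR36-FULL-NV-SLIM» — the SLIM affine witness for the
residual hypothesis of the [AbsTopIII] Cor 3.6 / Cor 3.7 model column).
-/
import Literature.AnabelianGeometry.AbsoluteAnabelian.AbsTopIII.MLFGaloisModelAffineWitness
import HarnessLib

/-!
# [AbsTopIII] Def 3.1 (i) / Prop 3.2 (iv): the semilinear affine model object with its ANALYTIC topology
# — definitions (`Π₀^an(k)` is a topological group; the object `affineModelAn k`)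

S. Mochizuki, *Topics in absolute anabelian geometry III* [MochizukiAbsTopIII2015] (kurims manuscript
`paper:url-5493eb38cbb7`), Def 3.1 (i) p. 66, Prop 3.2 (iv) p. 72 ("[...] this injection is a bijection
if [...] both [pairs] are of strictly Belyi type"; "if `(Π ↷ M_T)` is of hyperbolic orbicurve type, then
[...] center-free"; "`𝒞^{MLF-sB}_T` [...] are id-rigid"), Rmk 3.1.1 p. 70 (the topology of `k̄`).

MODEL / WITNESS DEFINITIONS (seat abc-iut-w5-d053 gen 4).  `MLFGaloisModelAffineWitness*.lean` built the
affine witness `affineModel k = (Π₀(k) ↠ G_k ↷ ℚ̄_p)`, `Π₀(k) = ℚ̄_p ⋊ (ℚ̄_p^× ⋊ G_k)` with the DISCRETE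
topology, at whose (nonempty) type the residual hypothesis `Full` of the Cor 3.6 / 3.7 model column holds —
but a discrete `Π₀` is not SLIM, whereas the model column's theorems of record carry print's proxy hypothesis
"`Π_k` slim" (`logFrobeniusCompatible_model_of_full (hfull) (hP : ∀ A, P A → IsSlimGroup A.pair.Pi)`,
`model_of_cor_3_7_of_full`, `isIdRigid_fullSubcategory_of_slim`), and abc-iut-L4-t9's slim object (the
factor swap of `G × G`) is not Full.  This file equips the SAME group with its ANALYTIC topology:

  `AffPiAn k := AffPi k` (type synonym) with the topology induced by `(b, a, γ) ∈ ℚ̄_p × ℚ̄_p^× × G_k`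
  (`ℚ̄_p`, `ℚ̄_p^×` p-adic, `G_k` Krull),

a topological group because `G_k` acts on `ℚ̄_p` jointly continuously (by ISOMETRIES — the spectral norm —
with open stabilisers: `continuous_galSMul`), and the model object `affineModelAn k := (Π₀^an(k) ↠ G_k ↷ ℚ̄_p)`
(`ε` = the continuous projection) with its nonempty type `IsAffineModelAn`.  The proof-only companion
`MLFGaloisModelAffineWitnessSlimProofs.lean` shows `Π₀^an` IS SLIM and `Full` holds on `IsAffineModelAn`,
so print's proxy hypothesis set {slim, Full, Lemma 3.4, an object} of the model column is JOINTLY and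
NON-VACUOUSLY satisfiable, and instantiates the `_of_full` theorems verbatim.

HONEST FRAMING: `Π₀^an` is slim but NOT profinite / locally compact (`ℚ̄_p` is not locally compact) and NOT
of hyperbolic-orbicurve / strictly-Belyi type — a CONSISTENCY / NON-VACUITY witness for the typed hypothesis
structure, not a model of [AbsTopIII] Cor 1.10.  Instances only on this file's own type synonym `AffPiAn`;
no new `Prop` fact; nothing here bears on [IUTchIII] Cor. 3.12; instantiated ≠ endorsed.
-/

set_option autoImplicit false

noncomputable section

namespace Literature.AnabelianGeometry.AbsoluteAnabelian.AbsTopIII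

open Topology Filter

variable {p : ℕ} [hp : Fact p.Prime]

namespace TFModel

variable (k : IntermediateField ℚ_[p] (PadicAlgCl p))

/-! ## `G_k` acts on `ℚ̄_p` by isometries with open stabilisers, hence jointly continuously -/

/-- Galois automorphisms of `ℚ̄_p` are ISOMETRIES (the norm of `ℚ̄_p` is the spectral norm over `ℚ_p`;
Rmk 3.1.1: "the topology on the field `k̄` [...] is completely determined by the field structure").
[cite: MochizukiAbsTopIII2015, Remark 3.1.1 p.70] -/
theorem norm_galk_apply (γ : PadicAlgCl p ≃ₐ[k] PadicAlgCl p) (z : PadicAlgCl p) : ‖γ z‖ = ‖z‖ := by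
  have h := spectralNorm_eq_of_equiv (γ.restrictScalars ℚ_[p]) z
  rw [PadicAlgCl.spectralNorm_eq, PadicAlgCl.spectralNorm_eq] at h
  exact h.symm

/-- Point stabilisers of `G_k ↷ ℚ̄_p` are open in the Krull topology (they contain the open fixing
subgroup of the finite extension `k(x)`). [cite: MochizukiAbsTopIII2015, Definition 3.1 (i) p.66] -/
theorem isOpen_stabilizer_galk (x : PadicAlgCl p) :
    IsOpen ((MulAction.stabilizer (PadicAlgCl p ≃ₐ[k] PadicAlgCl p) x : Subgroup _) :
      Set (PadicAlgCl p ≃ₐ[k] PadicAlgCl p)) := by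
  haveI : FiniteDimensional k (IntermediateField.adjoin k {x}) :=
    IntermediateField.adjoin.finiteDimensional (Algebra.IsAlgebraic.isAlgebraic x).isIntegral
  refine Subgroup.isOpen_mono ?_ (IntermediateField.fixingSubgroup_isOpen (IntermediateField.adjoin k {x}))
  intro σ hσ
  exact (IntermediateField.mem_fixingSubgroup_iff _ _).mp hσ x
    (IntermediateField.subset_adjoin k {x} (Set.mem_singleton x))

/-- **The action `G_k × ℚ̄_p → ℚ̄_p` is jointly continuous** (Krull × p-adic topologies): near `(γ₀, t₀)`,
`‖γ t - γ₀ t₀‖ = ‖t - t₀‖` as soon as `γ t₀ = γ₀ t₀` (isometry), which holds on an open coset of the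
stabiliser of `t₀`. [cite: MochizukiAbsTopIII2015, Remark 3.1.1 p.70] -/
theorem continuous_galSMul :
    Continuous fun q : (PadicAlgCl p ≃ₐ[k] PadicAlgCl p) × PadicAlgCl p => q.1 q.2 := by
  refine continuous_iff_continuousAt.2 fun q₀ => ?_
  obtain ⟨γ₀, t₀⟩ := q₀
  rw [ContinuousAt, Metric.tendsto_nhds]
  intro ε hε
  -- the open coset `{γ | γ t₀ = γ₀ t₀}` and the ball of radius `ε` around `t₀`
  have hS : {γ : PadicAlgCl p ≃ₐ[k] PadicAlgCl p | γ t₀ = γ₀ t₀} ∈ 𝓝 γ₀ := by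
    have hopen : IsOpen {γ : PadicAlgCl p ≃ₐ[k] PadicAlgCl p | γ t₀ = γ₀ t₀} := by
      have h := (isOpen_stabilizer_galk k t₀).preimage (continuous_const_mul γ₀⁻¹)
      convert h using 1
      ext γ
      simp only [Set.mem_setOf_eq, Set.mem_preimage, SetLike.mem_coe, MulAction.mem_stabilizer_iff,
        AlgEquiv.smul_def, AlgEquiv.mul_apply]
      constructor
      · intro e; rw [e, ← AlgEquiv.mul_apply, inv_mul_cancel, AlgEquiv.one_apply]
      · intro e
        have := congrArg γ₀ e
        rwa [← AlgEquiv.mul_apply, ← AlgEquiv.mul_apply, mul_inv_cancel, one_mul] at this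
    exact hopen.mem_nhds rfl
  have hB : Metric.ball t₀ ε ∈ 𝓝 t₀ := Metric.ball_mem_nhds t₀ hε
  filter_upwards [prod_mem_nhds hS hB] with q hq
  obtain ⟨hq1, hq2⟩ := hq
  simp only [Set.mem_setOf_eq] at hq1
  rw [Metric.mem_ball] at hq2
  rw [dist_eq_norm, ← hq1, ← map_sub, norm_galk_apply, ← dist_eq_norm]
  exact hq2

/-! ## The analytic topology: `Π₀^an(k) = ℚ̄_p ⋊ (ℚ̄_p^× ⋊ G_k)` as a topological group -/

/-- **`Π₀^an(k)`**: the semilinear affine group `Π₀(k) = AffPi k` of `MLFGaloisModelAffineWitness.lean`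
(same group), as a type synonym to carry the ANALYTIC topology instead of the discrete one.
[cite: MochizukiAbsTopIII2015, Definition 3.1 (i) p.66] -/
def AffPiAn : Type := AffPi k

namespace AffPiAn

variable {k}

/-- The group structure of `Π₀^an(k)` is that of `Π₀(k)` (instance on the synonym).
[cite: MochizukiAbsTopIII2015, Definition 3.1 (i) p.66] -/
instance : Group (AffPiAn k) := inferInstanceAs (Group (AffPi k))

/-- The identity `Π₀^an(k) ≃ Π₀(k)` of underlying groups. [cite: MochizukiAbsTopIII2015, Definition 3.1 (i) p.66] -/
def toAff : AffPiAn k ≃* AffPi k := MulEquiv.refl (AffPi k)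

/-- `toAff` is the identity map. [cite: MochizukiAbsTopIII2015, Definition 3.1 (i) p.66] -/
@[simp] theorem toAff_apply (x : AffPiAn k) : toAff x = (show AffPi k from x) := rfl

/-- The coordinate map `(b, a, γ) ∈ ℚ̄_p × ℚ̄_p^× × G_k`. [cite: MochizukiAbsTopIII2015, Definition 3.1 (i) p.66] -/
def coords (x : AffPiAn k) :
    PadicAlgCl p × (PadicAlgCl p)ˣ × (PadicAlgCl p ≃ₐ[k] PadicAlgCl p) :=
  ((toAff x).t, (toAff x).u, (toAff x).γ)

/-- **The analytic topology** on `Π₀^an(k)`: induced by the coordinates from `ℚ̄_p` (p-adic) × `ℚ̄_p^×`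
(p-adic units) × `G_k` (Krull) (instance on the synonym). [cite: MochizukiAbsTopIII2015, Remark 3.1.1 p.70] -/
instance : TopologicalSpace (AffPiAn k) := TopologicalSpace.induced coords inferInstance

/-- The coordinate map is continuous. [cite: MochizukiAbsTopIII2015, Remark 3.1.1 p.70] -/
theorem continuous_coords : Continuous (coords (k := k)) := continuous_induced_dom

/-- The translation coordinate is continuous. [cite: MochizukiAbsTopIII2015, Remark 3.1.1 p.70] -/
theorem continuous_t : Continuous fun x : AffPiAn k => (toAff x).t := continuous_fst.comp continuous_coords

/-- The dilation coordinate is continuous. [cite: MochizukiAbsTopIII2015, Remark 3.1.1 p.70] -/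
theorem continuous_u : Continuous fun x : AffPiAn k => (toAff x).u :=
  continuous_fst.comp (continuous_snd.comp continuous_coords)

/-- The Galois coordinate is continuous. [cite: MochizukiAbsTopIII2015, Remark 3.1.1 p.70] -/
theorem continuous_γ : Continuous fun x : AffPiAn k => (toAff x).γ :=
  continuous_snd.comp (continuous_snd.comp continuous_coords)

/-- A map into `Π₀^an(k)` is continuous iff its three coordinates are.
[cite: MochizukiAbsTopIII2015, Remark 3.1.1 p.70] -/
theorem continuous_of_coords {X : Type*} [TopologicalSpace X] {f : X → AffPiAn k}
    (ht : Continuous fun x => (toAff (f x)).t) (hu : Continuous fun x => (toAff (f x)).u)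
    (hγ : Continuous fun x => (toAff (f x)).γ) : Continuous f :=
  continuous_induced_rng.2 (ht.prodMk (hu.prodMk hγ))

/-- A map into `ℚ̄_p^×` is continuous if its value and the value of its inverse are.
[cite: MochizukiAbsTopIII2015, Remark 3.1.1 p.70] -/
theorem continuous_units {X : Type*} [TopologicalSpace X] {f : X → (PadicAlgCl p)ˣ}
    (h1 : Continuous fun x => (f x : PadicAlgCl p)) (h2 : Continuous fun x => ((f x)⁻¹ : (PadicAlgCl p)ˣ).val) :
    Continuous f :=
  Units.continuous_iff.2 ⟨h1, h2⟩

/-- `(x, γ, t) ↦ γ t`-type composites are continuous (joint continuity of the Galois action).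
[cite: MochizukiAbsTopIII2015, Remark 3.1.1 p.70] -/
theorem continuous_gal_apply {X : Type*} [TopologicalSpace X]
    {g : X → (PadicAlgCl p ≃ₐ[k] PadicAlgCl p)} {t : X → PadicAlgCl p} (hg : Continuous g) (ht : Continuous t) :
    Continuous fun x => g x (t x) :=
  (continuous_galSMul k).comp (hg.prodMk ht)

/-- **`Π₀^an(k)` is a topological group** (the composition law `(b₁,a₁,γ₁)·(b₂,a₂,γ₂) =
(b₁ + a₁γ₁(b₂), a₁γ₁(a₂), γ₁γ₂)` and the inverse are continuous in the analytic topology) — instance on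
the synonym. [cite: MochizukiAbsTopIII2015, Remark 3.1.1 p.70] -/
instance : IsTopologicalGroup (AffPiAn k) where
  continuous_mul := by
    have h1t : Continuous fun q : AffPiAn k × AffPiAn k => (toAff q.1).t := continuous_t.comp continuous_fst
    have h1u : Continuous fun q : AffPiAn k × AffPiAn k => (toAff q.1).u := continuous_u.comp continuous_fst
    have h1γ : Continuous fun q : AffPiAn k × AffPiAn k => (toAff q.1).γ := continuous_γ.comp continuous_fst
    have h2t : Continuous fun q : AffPiAn k × AffPiAn k => (toAff q.2).t := continuous_t.comp continuous_snd
    have h2u : Continuous fun q : AffPiAn k × AffPiAn k => (toAff q.2).u := continuous_u.comp continuous_snd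
    have h2γ : Continuous fun q : AffPiAn k × AffPiAn k => (toAff q.2).γ := continuous_γ.comp continuous_snd
    refine continuous_of_coords ?_ ?_ ?_
    · change Continuous fun q : AffPiAn k × AffPiAn k =>
        (toAff q.1).t + (toAff q.1).u * (toAff q.1).γ (toAff q.2).t
      exact h1t.add ((Units.continuous_val.comp h1u).mul (continuous_gal_apply h1γ h2t))
    · change Continuous fun q : AffPiAn k × AffPiAn k => (toAff q.1).u * galUnits k (toAff q.1).γ (toAff q.2).u
      refine h1u.mul (continuous_units ?_ ?_)
      · change Continuous fun q : AffPiAn k × AffPiAn k => (toAff q.1).γ ((toAff q.2).u : PadicAlgCl p)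
        exact continuous_gal_apply h1γ (Units.continuous_val.comp h2u)
      · have e : (fun q : AffPiAn k × AffPiAn k => ((galUnits k (toAff q.1).γ (toAff q.2).u)⁻¹ : (PadicAlgCl p)ˣ).val)
            = fun q => (toAff q.1).γ (((toAff q.2).u⁻¹ : (PadicAlgCl p)ˣ) : PadicAlgCl p) := by
          funext q
          exact Units.coe_map_inv _ _
        rw [e]
        exact continuous_gal_apply h1γ (Units.continuous_coe_inv.comp h2u)
    · change Continuous fun q : AffPiAn k × AffPiAn k => (toAff q.1).γ * (toAff q.2).γ
      exact h1γ.mul h2γ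
  continuous_inv := by
    have hγ' : Continuous fun x : AffPiAn k => (toAff x).γ⁻¹ := continuous_γ.inv
    have hgu : Continuous fun x : AffPiAn k => galUnits k (toAff x).γ⁻¹ (toAff x).u := by
      refine continuous_units ?_ ?_
      · exact continuous_gal_apply hγ' (Units.continuous_val.comp continuous_u)
      · have e : (fun x : AffPiAn k => ((galUnits k (toAff x).γ⁻¹ (toAff x).u)⁻¹ : (PadicAlgCl p)ˣ).val)
            = fun x => (toAff x).γ⁻¹ (((toAff x).u⁻¹ : (PadicAlgCl p)ˣ) : PadicAlgCl p) := by
          funext x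
          exact Units.coe_map_inv _ _
        rw [e]
        exact continuous_gal_apply hγ' (Units.continuous_coe_inv.comp continuous_u)
    refine continuous_of_coords ?_ ?_ ?_
    · change Continuous fun x : AffPiAn k =>
        -(((galUnits k (toAff x).γ⁻¹ (toAff x).u)⁻¹ : (PadicAlgCl p)ˣ) : PadicAlgCl p) * (toAff x).γ⁻¹ (toAff x).t
      exact ((Units.continuous_coe_inv.comp hgu).neg).mul (continuous_gal_apply hγ' continuous_t)
    · change Continuous fun x : AffPiAn k => (galUnits k (toAff x).γ⁻¹ (toAff x).u)⁻¹
      exact hgu.inv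
    · exact hγ'

/-- The projection **`ε : Π₀^an(k) ↠ G_k`** (the `ε` of `Π₀(k)`). [cite: MochizukiAbsTopIII2015, Definition 3.1 (i) p.66] -/
def ε : AffPiAn k →* (PadicAlgCl p ≃ₐ[k] PadicAlgCl p) := AffPi.ε.comp toAff.toMonoidHom

/-- `ε x` is the Galois coordinate of `x`. [cite: MochizukiAbsTopIII2015, Definition 3.1 (i) p.66] -/
@[simp] theorem ε_apply (x : AffPiAn k) : ε x = (toAff x).γ := rfl

/-- `ε` is continuous (a coordinate projection). [cite: MochizukiAbsTopIII2015, Definition 3.1 (i) p.66] -/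
theorem continuous_ε : Continuous (ε (k := k)) := continuous_γ

/-- `ε` is surjective. [cite: MochizukiAbsTopIII2015, Definition 3.1 (i) p.66] -/
theorem ε_surjective : Function.Surjective (ε (k := k)) := fun γ =>
  ⟨(show AffPiAn k from AffPi.lift γ), rfl⟩

/-- The translation `x ↦ x + b` as an element of `Π₀^an(k)`. [cite: MochizukiAbsTopIII2015, Definition 3.1 (i) p.66] -/
def tr (b : PadicAlgCl p) : AffPiAn k := (show AffPiAn k from AffPi.tr b)

/-- The dilation `x ↦ a·x` as an element of `Π₀^an(k)`. [cite: MochizukiAbsTopIII2015, Definition 3.1 (i) p.66] -/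
def dil (a : (PadicAlgCl p)ˣ) : AffPiAn k := (show AffPiAn k from AffPi.dil a)

/-- `toAff (tr b) = AffPi.tr b`. [cite: MochizukiAbsTopIII2015, Definition 3.1 (i) p.66] -/
@[simp] theorem toAff_tr (b : PadicAlgCl p) : toAff (tr b : AffPiAn k) = AffPi.tr b := rfl

/-- `toAff (dil a) = AffPi.dil a`. [cite: MochizukiAbsTopIII2015, Definition 3.1 (i) p.66] -/
@[simp] theorem toAff_dil (a : (PadicAlgCl p)ˣ) : toAff (dil a : AffPiAn k) = AffPi.dil a := rfl

/-- `b ↦ tr b` is continuous (`ℚ̄_p → Π₀^an(k)`). [cite: MochizukiAbsTopIII2015, Remark 3.1.1 p.70] -/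
theorem continuous_tr : Continuous (tr (k := k)) :=
  continuous_of_coords continuous_id continuous_const continuous_const

/-- `a ↦ dil a` is continuous (`ℚ̄_p^× → Π₀^an(k)`). [cite: MochizukiAbsTopIII2015, Remark 3.1.1 p.70] -/
theorem continuous_dil : Continuous (dil (k := k)) :=
  continuous_of_coords continuous_const continuous_id continuous_const

end AffPiAn

/-! ## The SLIM witness object `affineModelAn k = (Π₀^an(k) ↠ G_k ↷ ℚ̄_p)` -/

variable [FiniteDimensional ℚ_[p] k]

/-- **The analytic affine model object** `(Π₀^an(k) ↠ G_k ↷ ℚ̄_p)` over the MLF `k`: Def 3.1 (i) model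
data with `Π_k := Π₀^an(k)` and `ε_k` the continuous surjective projection.
[cite: MochizukiAbsTopIII2015, Definition 3.1 (i) p.66] -/
def affineModelAn : TFModel p where
  k := k
  D := { Pi := AffPiAn k
         aug := AffPiAn.ε
         continuous_aug := AffPiAn.continuous_ε
         aug_surjective := AffPiAn.ε_surjective }

/-- The Galois group of `affineModelAn k` is `Π₀^an(k)`. [cite: MochizukiAbsTopIII2015, Definition 3.1 (i) p.67] -/
theorem affineModelAn_Pi : (affineModelAn k).pair.Pi = AffPiAn k := rfl

/-- The action of `x ∈ Π₀^an(k)` on `ℚ̄_p` is through its Galois coordinate.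
[cite: MochizukiAbsTopIII2015, Definition 3.1 (i) p.67] -/
theorem affineModelAn_augQ_apply (g : (affineModelAn k).pair.Pi) (x : PadicAlgCl p) :
    (affineModelAn k).augQ g x = (AffPiAn.toAff (show AffPiAn k from g)).γ x := rfl

/-- The type `P₀^an` of analytic witness objects: `A = affineModelAn k` for some MLF `k ⊆ ℚ̄_p`.
[cite: MochizukiAbsTopIII2015, Definition 3.1 (iii) p.68] -/
def IsAffineModelAn : CategoryTheory.ObjectProperty (TFModel p) := fun A =>
  ∃ (k : IntermediateField ℚ_[p] (PadicAlgCl p)) (_ : FiniteDimensional ℚ_[p] k), A = affineModelAn k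

/-- `affineModelAn k ∈ P₀^an`. [cite: MochizukiAbsTopIII2015, Definition 3.1 (iii) p.68] -/
theorem isAffineModelAn_affineModelAn : IsAffineModelAn (affineModelAn k) := ⟨k, inferInstance, rfl⟩

/-- `P₀^an` is inhabited (by the object over `k = ℚ_p`). [cite: MochizukiAbsTopIII2015, Definition 3.1 (iii) p.68] -/
theorem nonempty_isAffineModelAn_fullSubcategory :
    Nonempty (IsAffineModelAn (p := p)).FullSubcategory :=
  ⟨⟨affineModelAn ⊥, isAffineModelAn_affineModelAn ⊥⟩⟩

end TFModel

end Literature.AnabelianGeometry.AbsoluteAnabelian.AbsTopIII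

end
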